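import Mathlib
import Literature.FieldTheory.QuasiAlgClosed.Basic
import Literature.Combinatorics.StablePolynomials.Basic
import HarnessLib

/-!
# Hyperbolic polynomials and the (closed) hyperbolicity cone

Topic `Literature/AlgebraicGeometry/HyperbolicPolynomials`. Vocabulary requested by route
`ValiantsHypothesis/PermanentalCones` (items `PermanentalConesEasy`, `HyperbolicDetShadow`,
`PermanentalConeHard`, `HyperbolicVPShadow`, `PermanentalHyperbolic`), whose statements inline
"`f(e) ≠ 0` and `z ↦ f(x + z e)` has only real zeros" and the closed cone
"`{x | ∀ τ > 0, f(x + τ e) ≠ 0}`".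

Sources. L. Gårding, *An inequality for hyperbolic polynomials*, J. Math. Mech. 8 (1959);
J. Renegar, *Hyperbolic programs, and their derivative relaxations*, Found. Comput. Math. 6
(2006), §2; J. Saunderson, P. Parrilo, *Polynomial-sized semidefinite representations of
derivative relaxations of spectrahedral cones*, Math. Program. 153 (2015) (arXiv:1208.1443), §1.1.

## Contents (namespace `Literature.AlgebraicGeometry.HyperbolicPolynomials`)

Definitions (all with bodies):
* `IsHyperbolic f e` (`f : MvPolynomial σ ℝ`, `e : σ → ℝ`): `f(e) ≠ 0` and every complex zero
  `z` of `z ↦ f(x + z e)` (`x` real) is real — Renegar 2006, §2 / Gårding 1959. Homogeneity is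
  *not* bundled (state `f.IsHomogeneous d` separately), exactly as in the route items.
* `hyperbolicityCone f e = {x | ∀ τ > 0, f(x + τ e) ≠ 0}` — the **closed** hyperbolicity cone
  `Λ₊(f, e)` in root-free form; for `f` hyperbolic and homogeneous this is Renegar's
  `Λ₊ = {x : λ_min(x) ≥ 0}` (`mem_hyperbolicityCone_iff_eigenvalues_nonneg`), the closure of
  the open cone `Λ₊₊`.
* `openHyperbolicityCone f e = {x | ∀ τ ≥ 0, f(x + τ e) ≠ 0}` — Renegar's / Gårding's open cone
  `Λ₊₊ = {x : λ_min(x) > 0}` (`mem_openHyperbolicityCone_iff_eigenvalues_pos`).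
* `linePoly f x e ∈ ℝ[t]`, the restriction `t ↦ f(x + t e)` (`eval_linePoly`), and
  `eigenvalues f e x` — the roots of Renegar's characteristic polynomial `λ ↦ f(λ e − x)`,
  realised as the negatives of the roots of `linePoly f x e`.

Proved API:
* unfolding lemmas; `isHyperbolic_mul_iff`, `IsHyperbolic.mul/.pow/.C_mul`,
  `isHyperbolic_neg_iff`; `hyperbolicityCone_mul/_pow/_C_mul/_smul/_neg`
  (`Λ₊(fg) = Λ₊(f) ∩ Λ₊(g)`, invariance under `f ↦ f^k`, `f ↦ c f`);
* root formulations: `mem_hyperbolicityCone_iff_forall_root_nonpos` (the real roots of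
  `t ↦ f(x + te)` are `≤ 0`), `IsHyperbolic.mem_hyperbolicityCone_iff_complex` (the complex roots
  have `Re ≤ 0`), and the same for `Λ₊₊` with strict inequalities;
* the real factorisation along lines for hyperbolic `f` (`IsHyperbolic.roots_map_linePoly`,
  `IsHyperbolic.card_roots_linePoly`, `IsHyperbolic.eval_add_smul_eq_prod_roots`), and with
  homogeneity `natDegree_linePoly`, `leadingCoeff_linePoly`, `mem_eigenvalues_iff`,
  `card_eigenvalues`, **`eval_add_smul_eq_eval_mul_prod_eigenvalues`**:
  `f(x + t e) = f(e) ∏ᵢ (t + λᵢ(x))`, and Renegar's `f(x) = f(e) ∏ᵢ λᵢ(x)`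
  (`eval_eq_eval_mul_prod_eigenvalues`);
* cone membership through eigenvalues (`mem_hyperbolicityCone_iff_eigenvalues_nonneg`,
  `mem_openHyperbolicityCone_iff_eigenvalues_pos`), `0 ∈ Λ₊`, `e ∈ Λ₊₊ ⊆ Λ₊`, positive scaling,
  `x ∈ Λ₊ → x + t e ∈ Λ₊₊` (`t > 0`), the lower bound `|f(e)| τ^d ≤ |f(x + τ e)|` on `Λ₊`
  and **closedness of `Λ₊`** (`isClosed_hyperbolicityCone`);
* linear pull-backs `f ∘ A` keeping the direction (`hyperbolicityCone_bind₁_linear`: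
  `Λ₊(f ∘ A, e') = A⁻¹ Λ₊(f, A e')`; `IsHyperbolic.bind₁_linear`);
* examples: `∏ᵢ Xᵢ` is hyperbolic w.r.t. `𝟙` with closed cone the nonnegative orthant and open
  cone the positive orthant (`isHyperbolic_prod_X`, `hyperbolicityCone_prod_X`,
  `openHyperbolicityCone_prod_X`); real stable polynomials are hyperbolic w.r.t. every positive
  direction at which they do not vanish, and real stable *forms* vanish at no positive point
  (`isHyperbolic_of_isRealStable`, `eval_ne_zero_of_isRealStable`,
  `isHyperbolic_of_isRealStable_of_isHomogeneous` — Brändén's line criterion, from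
  `Literature.Combinatorics.StablePolynomials`).

## Not in this file

Gårding's theorems (Renegar 2006, Thms 2–3: `Λ₊₊` is convex and `f` is hyperbolic w.r.t. every
point of `Λ₊₊`, with the same cone; `Λ₊₊` is the component of `{f ≠ 0}` containing `e`) need
continuity of the roots in a parameter and are left to a companion file; so is the PSD example
(`det` on symmetric matrices). No named facts are introduced here.

## Design / Mathlib

Mathlib has no hyperbolic polynomials (`Matrix.IsHyperbolic` in
`Mathlib/LinearAlgebra/Matrix/GeneralLinearGroup/FinTwo.lean` is the unrelated notion for
`GL₂`); searched `hyperbolicityCone`, `IsHyperbolic`, `hyperbolic polynomial`. The complex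
evaluation is written *literally* as in the route items,
`MvPolynomial.eval (fun j => (x j : ℂ) + z * (e j : ℂ)) (MvPolynomial.map (algebraMap ℝ ℂ) f)`,
so that those items restate by `Iff.rfl`; `eval_map_linePoly` identifies it with the
complexified line polynomial.

## References

* [Garding1959] L. Gårding, *An inequality for hyperbolic polynomials*, J. Math. Mech. 8 (1959)
  957–965 (definition of hyperbolicity, the cone, convexity; as reproved in Renegar 2006 §2).
* [Renegar2006] J. Renegar, *Hyperbolic programs, and their derivative relaxations*, Found.
  Comput. Math. 6 (2006) 59–79: §2 (hyperbolic in direction `e`; characteristic polynomial and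
  eigenvalues; `p(x) = p(e) ∏ λⱼ(x)`; `Λ₊₊`, `Λ₊`; Prop. 1, Thms 2–3).
* [SaundersonParrilo2014] J. Saunderson, P. A. Parrilo, Math. Program. 153 (2015) 309–331
  (arXiv:1208.1443): §1.1 (closed hyperbolicity cone `Λ₊(p,e)`; orthant and PSD examples).
-/

noncomputable section

open MvPolynomial
open scoped BigOperators Polynomial

namespace Literature.AlgebraicGeometry.HyperbolicPolynomials

variable {σ : Type*}

/-! ### Definitions -/

/-- **Hyperbolic polynomial in direction `e`** (Renegar 2006, §2: "`p` is said to be hyperbolic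
if there exists a direction `e`, `p(e) ≠ 0`, with the property that for each `x`, the univariate
polynomial `t ↦ p(x + te)` has only real roots … hyperbolic in direction `e`"; Gårding 1959):
`f(e) ≠ 0` and every complex zero `z` of `z ↦ f(x + z e)`, `x ∈ ℝ^σ`, has `Im z = 0`.
Homogeneity of `f` is part of Renegar's standing convention but is *not* bundled here; add
`f.IsHomogeneous d` where needed.
[cite: Renegar2006, §2 (definition of hyperbolic in direction e)] -/
def IsHyperbolic (f : MvPolynomial σ ℝ) (e : σ → ℝ) : Prop :=
  MvPolynomial.eval e f ≠ 0 ∧ ∀ (x : σ → ℝ) (z : ℂ),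
    MvPolynomial.eval (fun j => (x j : ℂ) + z * (e j : ℂ)) (MvPolynomial.map (algebraMap ℝ ℂ) f)
      = 0 → z.im = 0

/-- **Closed hyperbolicity cone** `Λ₊(f, e)` in root-free form: the points `x` such that
`f(x + τ e) ≠ 0` for all `τ > 0`, i.e. all real roots of `t ↦ f(x + te)` are `≤ 0`, i.e. (for `f`
hyperbolic and homogeneous) all eigenvalues of `x` are `≥ 0` — Renegar 2006, §2:
"`Λ₊ := {x : λ_min(x) ≥ 0}` … the closure of `Λ₊₊`"; Saunderson–Parrilo, §1.1: "its closure
`Λ₊(p,e)` … the closed hyperbolicity cone". [cite: Renegar2006, §2 (definition of Λ₊)] -/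
def hyperbolicityCone (f : MvPolynomial σ ℝ) (e : σ → ℝ) : Set (σ → ℝ) :=
  {x | ∀ τ : ℝ, 0 < τ → MvPolynomial.eval (x + τ • e) f ≠ 0}

/-- **Open hyperbolicity cone** `Λ₊₊(f, e)` in root-free form: `f(x + τ e) ≠ 0` for all `τ ≥ 0`,
i.e. (for `f` hyperbolic and homogeneous) all eigenvalues of `x` are `> 0` — Renegar 2006, §2:
"The set `Λ₊₊ := {x : λ_min(x) > 0}` is the hyperbolicity cone (for `p` in direction `e`)";
Gårding's `Γ(P, ξ)`. [cite: Renegar2006, §2 (definition of Λ₊₊)] -/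
def openHyperbolicityCone (f : MvPolynomial σ ℝ) (e : σ → ℝ) : Set (σ → ℝ) :=
  {x | ∀ τ : ℝ, 0 ≤ τ → MvPolynomial.eval (x + τ • e) f ≠ 0}

/-! ### Unfolding -/

/-- Unfolding `IsHyperbolic` (the form inlined by the route items). [folklore] -/
theorem isHyperbolic_iff (f : MvPolynomial σ ℝ) (e : σ → ℝ) :
    IsHyperbolic f e ↔ MvPolynomial.eval e f ≠ 0 ∧ ∀ (x : σ → ℝ) (z : ℂ),
      MvPolynomial.eval (fun j => (x j : ℂ) + z * (e j : ℂ)) (MvPolynomial.map (algebraMap ℝ ℂ) f)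
        = 0 → z.im = 0 :=
  Iff.rfl

/-- Unfolding `hyperbolicityCone` (the form inlined by the route items). [folklore] -/
@[simp] theorem mem_hyperbolicityCone_iff (f : MvPolynomial σ ℝ) (e x : σ → ℝ) :
    x ∈ hyperbolicityCone f e ↔ ∀ τ : ℝ, 0 < τ → MvPolynomial.eval (x + τ • e) f ≠ 0 :=
  Iff.rfl

/-- Unfolding `openHyperbolicityCone`. [folklore] -/
@[simp] theorem mem_openHyperbolicityCone_iff (f : MvPolynomial σ ℝ) (e x : σ → ℝ) :
    x ∈ openHyperbolicityCone f e ↔ ∀ τ : ℝ, 0 ≤ τ → MvPolynomial.eval (x + τ • e) f ≠ 0 :=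
  Iff.rfl

/-- A hyperbolic polynomial does not vanish at its direction. [cite: Renegar2006, §2] -/
theorem IsHyperbolic.eval_ne_zero {f : MvPolynomial σ ℝ} {e : σ → ℝ} (h : IsHyperbolic f e) :
    MvPolynomial.eval e f ≠ 0 :=
  h.1

/-- A hyperbolic polynomial is nonzero. [folklore] -/
theorem IsHyperbolic.ne_zero {f : MvPolynomial σ ℝ} {e : σ → ℝ} (h : IsHyperbolic f e) :
    f ≠ 0 := by
  rintro rfl
  exact h.1 (map_zero _)

/-- The complex zeros of `z ↦ f(x + z e)` are real. [cite: Renegar2006, §2] -/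
theorem IsHyperbolic.im_eq_zero {f : MvPolynomial σ ℝ} {e : σ → ℝ} (h : IsHyperbolic f e)
    (x : σ → ℝ) {z : ℂ}
    (hz : MvPolynomial.eval (fun j => (x j : ℂ) + z * (e j : ℂ))
      (MvPolynomial.map (algebraMap ℝ ℂ) f) = 0) :
    z.im = 0 :=
  h.2 x z hz

/-- The complexified evaluation at a real parameter `t` is the real evaluation at `x + t e`.
[folklore] -/
theorem eval_map_ofReal_line (f : MvPolynomial σ ℝ) (x e : σ → ℝ) (t : ℝ) :
    MvPolynomial.eval (fun j => (x j : ℂ) + (t : ℂ) * (e j : ℂ))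
        (MvPolynomial.map (algebraMap ℝ ℂ) f)
      = ((MvPolynomial.eval (x + t • e) f : ℝ) : ℂ) := by
  rw [← Complex.coe_algebraMap, MvPolynomial.map_eval (algebraMap ℝ ℂ) (x + t • e) f]
  refine congrArg (fun g : σ → ℂ => MvPolynomial.eval g (MvPolynomial.map (algebraMap ℝ ℂ) f)) ?_
  funext j
  simp

/-- The open cone is contained in the closed cone. [cite: Renegar2006, §2] -/
theorem openHyperbolicityCone_subset (f : MvPolynomial σ ℝ) (e : σ → ℝ) :
    openHyperbolicityCone f e ⊆ hyperbolicityCone f e :=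
  fun _ hx τ hτ => hx τ hτ.le

/-- A point of the open cone is not a zero of `f` (`τ = 0`). [cite: Renegar2006, §2] -/
theorem eval_ne_zero_of_mem_openHyperbolicityCone {f : MvPolynomial σ ℝ} {e x : σ → ℝ}
    (hx : x ∈ openHyperbolicityCone f e) : MvPolynomial.eval x f ≠ 0 := by
  simpa using hx 0 le_rfl

/-- Renegar 2006, §2: "if `x ∈ Λ₊`, then `x + te ∈ Λ₊₊` for all `t > 0`".
[cite: Renegar2006, §2] -/
theorem add_smul_mem_openHyperbolicityCone {f : MvPolynomial σ ℝ} {e x : σ → ℝ}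
    (hx : x ∈ hyperbolicityCone f e) {t : ℝ} (ht : 0 < t) :
    x + t • e ∈ openHyperbolicityCone f e := by
  intro τ hτ
  have := hx (t + τ) (by linarith)
  rwa [add_smul, ← add_assoc] at this

/-- Translating along the direction keeps a point in the closed cone. [folklore] -/
theorem add_smul_mem_hyperbolicityCone {f : MvPolynomial σ ℝ} {e x : σ → ℝ}
    (hx : x ∈ hyperbolicityCone f e) {t : ℝ} (ht : 0 ≤ t) :
    x + t • e ∈ hyperbolicityCone f e := by
  intro τ hτ
  have := hx (t + τ) (by linarith)
  rwa [add_smul, ← add_assoc] at this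

/-! ### Root formulations of cone membership -/

/-- `x ∈ Λ₊(f,e)` iff every real root of `t ↦ f(x + te)` is `≤ 0` (equivalently, with Renegar's
sign convention `λ ↦ f(λe − x)` for homogeneous `f`, every real eigenvalue is `≥ 0`). Pure logic,
no hyperbolicity needed. [cite: Renegar2006, §2] -/
theorem mem_hyperbolicityCone_iff_forall_root_nonpos (f : MvPolynomial σ ℝ) (e x : σ → ℝ) :
    x ∈ hyperbolicityCone f e ↔ ∀ t : ℝ, MvPolynomial.eval (x + t • e) f = 0 → t ≤ 0 := by
  simp only [mem_hyperbolicityCone_iff]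
  constructor
  · intro h t ht
    by_contra hlt
    exact h t (lt_of_not_ge hlt) ht
  · intro h τ hτ hzero
    exact absurd (h τ hzero) (not_le.mpr hτ)

/-- `x ∈ Λ₊₊(f,e)` iff every real root of `t ↦ f(x + te)` is `< 0`. [cite: Renegar2006, §2] -/
theorem mem_openHyperbolicityCone_iff_forall_root_neg (f : MvPolynomial σ ℝ) (e x : σ → ℝ) :
    x ∈ openHyperbolicityCone f e ↔ ∀ t : ℝ, MvPolynomial.eval (x + t • e) f = 0 → t < 0 := by
  simp only [mem_openHyperbolicityCone_iff]
  constructor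
  · intro h t ht
    by_contra hlt
    exact h t (le_of_not_gt hlt) ht
  · intro h τ hτ hzero
    exact absurd (h τ hzero) (not_lt.mpr hτ)

/-- For hyperbolic `f`: `x ∈ Λ₊(f,e)` iff every *complex* zero `z` of `z ↦ f(x + z e)` has
`Re z ≤ 0` (all such zeros being real). [cite: Renegar2006, §2] -/
theorem IsHyperbolic.mem_hyperbolicityCone_iff_complex {f : MvPolynomial σ ℝ} {e : σ → ℝ}
    (h : IsHyperbolic f e) (x : σ → ℝ) :
    x ∈ hyperbolicityCone f e ↔ ∀ z : ℂ,
      MvPolynomial.eval (fun j => (x j : ℂ) + z * (e j : ℂ)) (MvPolynomial.map (algebraMap ℝ ℂ) f)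
        = 0 → z.re ≤ 0 := by
  rw [mem_hyperbolicityCone_iff_forall_root_nonpos]
  constructor
  · intro hx z hz
    have him : z.im = 0 := h.im_eq_zero x hz
    have hzre : z = (z.re : ℂ) := by
      apply Complex.ext <;> simp [him]
    rw [hzre, eval_map_ofReal_line] at hz
    exact hx z.re (by exact_mod_cast hz)
  · intro hx t ht
    have := hx (t : ℂ) (by rw [eval_map_ofReal_line, ht]; simp)
    simpa using this

/-! ### Products, powers, scalars -/

/-- `Λ₊(fg, e) = Λ₊(f, e) ∩ Λ₊(g, e)`. [folklore] -/
theorem hyperbolicityCone_mul (f g : MvPolynomial σ ℝ) (e : σ → ℝ) :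
    hyperbolicityCone (f * g) e = hyperbolicityCone f e ∩ hyperbolicityCone g e := by
  ext x
  simp only [mem_hyperbolicityCone_iff, map_mul, mul_ne_zero_iff, Set.mem_inter_iff]
  exact ⟨fun h => ⟨fun τ hτ => (h τ hτ).1, fun τ hτ => (h τ hτ).2⟩,
    fun h τ hτ => ⟨h.1 τ hτ, h.2 τ hτ⟩⟩

/-- `Λ₊₊(fg, e) = Λ₊₊(f, e) ∩ Λ₊₊(g, e)`. [folklore] -/
theorem openHyperbolicityCone_mul (f g : MvPolynomial σ ℝ) (e : σ → ℝ) :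
    openHyperbolicityCone (f * g) e = openHyperbolicityCone f e ∩ openHyperbolicityCone g e := by
  ext x
  simp only [mem_openHyperbolicityCone_iff, map_mul, mul_ne_zero_iff, Set.mem_inter_iff]
  exact ⟨fun h => ⟨fun τ hτ => (h τ hτ).1, fun τ hτ => (h τ hτ).2⟩,
    fun h τ hτ => ⟨h.1 τ hτ, h.2 τ hτ⟩⟩

/-- `Λ₊(f^k, e) = Λ₊(f, e)` for `k ≠ 0`. [folklore] -/
theorem hyperbolicityCone_pow (f : MvPolynomial σ ℝ) (e : σ → ℝ) {k : ℕ} (hk : k ≠ 0) :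
    hyperbolicityCone (f ^ k) e = hyperbolicityCone f e := by
  ext x
  simp [mem_hyperbolicityCone_iff, map_pow, pow_ne_zero_iff hk]

/-- `Λ₊(c f, e) = Λ₊(f, e)` for `c ≠ 0`. [folklore] -/
theorem hyperbolicityCone_C_mul (f : MvPolynomial σ ℝ) (e : σ → ℝ) {c : ℝ} (hc : c ≠ 0) :
    hyperbolicityCone (C c * f) e = hyperbolicityCone f e := by
  ext x
  simp [mem_hyperbolicityCone_iff, map_mul, hc]

/-- `Λ₊(c • f, e) = Λ₊(f, e)` for `c ≠ 0`. [folklore] -/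
theorem hyperbolicityCone_smul (f : MvPolynomial σ ℝ) (e : σ → ℝ) {c : ℝ} (hc : c ≠ 0) :
    hyperbolicityCone (c • f) e = hyperbolicityCone f e := by
  rw [smul_eq_C_mul, hyperbolicityCone_C_mul f e hc]

/-- `Λ₊(−f, e) = Λ₊(f, e)` (Saunderson–Parrilo §1.1: "`p` is hyperbolic w.r.t. `e` iff `−p`
is"). [cite: SaundersonParrilo2014, §1.1] -/
theorem hyperbolicityCone_neg (f : MvPolynomial σ ℝ) (e : σ → ℝ) :
    hyperbolicityCone (-f) e = hyperbolicityCone f e := by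
  ext x
  simp [mem_hyperbolicityCone_iff]

/-- `fg` is hyperbolic w.r.t. `e` iff `f` and `g` are (Renegar 2006, §2: "if `p₁` and `p₂` are
hyperbolic in direction `e`, then so is `p₁p₂`"; the converse because a zero of a factor is a
zero of the product). [cite: Renegar2006, §2] -/
theorem isHyperbolic_mul_iff {f g : MvPolynomial σ ℝ} {e : σ → ℝ} :
    IsHyperbolic (f * g) e ↔ IsHyperbolic f e ∧ IsHyperbolic g e := by
  simp only [isHyperbolic_iff, map_mul, mul_ne_zero_iff, mul_eq_zero]
  constructor
  · rintro ⟨⟨hf, hg⟩, h⟩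
    exact ⟨⟨hf, fun x z hz => h x z (Or.inl hz)⟩, ⟨hg, fun x z hz => h x z (Or.inr hz)⟩⟩
  · rintro ⟨⟨hf, h₁⟩, ⟨hg, h₂⟩⟩
    exact ⟨⟨hf, hg⟩, fun x z hz => hz.elim (h₁ x z) (h₂ x z)⟩

/-- Products of hyperbolic polynomials are hyperbolic. [cite: Renegar2006, §2] -/
theorem IsHyperbolic.mul {f g : MvPolynomial σ ℝ} {e : σ → ℝ} (hf : IsHyperbolic f e)
    (hg : IsHyperbolic g e) : IsHyperbolic (f * g) e :=
  isHyperbolic_mul_iff.2 ⟨hf, hg⟩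

/-- Powers of hyperbolic polynomials are hyperbolic. [folklore] -/
theorem IsHyperbolic.pow {f : MvPolynomial σ ℝ} {e : σ → ℝ} (hf : IsHyperbolic f e) (k : ℕ) :
    IsHyperbolic (f ^ k) e := by
  induction k with
  | zero =>
      refine ⟨by simp, fun x z hz => ?_⟩
      simp at hz
  | succ k ih => rw [pow_succ]; exact ih.mul hf

/-- Nonzero scalar multiples of hyperbolic polynomials are hyperbolic. [folklore] -/
theorem IsHyperbolic.C_mul {f : MvPolynomial σ ℝ} {e : σ → ℝ} (hf : IsHyperbolic f e) {c : ℝ}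
    (hc : c ≠ 0) : IsHyperbolic (C c * f) e := by
  refine ⟨by simp [map_mul, hc, hf.eval_ne_zero], fun x z hz => hf.im_eq_zero x ?_⟩
  simpa [map_mul, MvPolynomial.map_C, hc] using hz

/-- `−f` is hyperbolic iff `f` is. [cite: SaundersonParrilo2014, §1.1] -/
theorem isHyperbolic_neg_iff {f : MvPolynomial σ ℝ} {e : σ → ℝ} :
    IsHyperbolic (-f) e ↔ IsHyperbolic f e := by
  simp [isHyperbolic_iff]


/-! ### Consequences of homogeneity -/

/-- For a form `f` with `f(e) ≠ 0`, the origin lies in `Λ₊` (`f(τe) = τ^d f(e)`). [folklore] -/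
theorem zero_mem_hyperbolicityCone {f : MvPolynomial σ ℝ} {d : ℕ} (hf : f.IsHomogeneous d)
    {e : σ → ℝ} (he : MvPolynomial.eval e f ≠ 0) : (0 : σ → ℝ) ∈ hyperbolicityCone f e := by
  intro τ hτ
  rw [zero_add, hf.eval_smul_eq]
  exact mul_ne_zero (pow_ne_zero _ hτ.ne') he

/-- Renegar 2006, §2: "Obviously, `e ∈ Λ₊₊`" (for a form with `f(e) ≠ 0`:
`f(e + τe) = (1 + τ)^d f(e)`). [cite: Renegar2006, §2] -/
theorem self_mem_openHyperbolicityCone {f : MvPolynomial σ ℝ} {d : ℕ} (hf : f.IsHomogeneous d)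
    {e : σ → ℝ} (he : MvPolynomial.eval e f ≠ 0) : e ∈ openHyperbolicityCone f e := by
  intro τ hτ
  have h1 : e + τ • e = (1 + τ) • e := by rw [add_smul, one_smul]
  rw [h1, hf.eval_smul_eq]
  exact mul_ne_zero (pow_ne_zero _ (by positivity)) he

/-- The direction lies in the closed cone. [cite: Renegar2006, §2] -/
theorem self_mem_hyperbolicityCone {f : MvPolynomial σ ℝ} {d : ℕ} (hf : f.IsHomogeneous d)
    {e : σ → ℝ} (he : MvPolynomial.eval e f ≠ 0) : e ∈ hyperbolicityCone f e :=
  openHyperbolicityCone_subset f e (self_mem_openHyperbolicityCone hf he)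

/-- `Λ₊` is invariant under positive scaling (Renegar 2006, §2: "`Λ₊₊` is indeed a cone").
[cite: Renegar2006, §2] -/
theorem smul_mem_hyperbolicityCone {f : MvPolynomial σ ℝ} {d : ℕ} (hf : f.IsHomogeneous d)
    {e x : σ → ℝ} (hx : x ∈ hyperbolicityCone f e) {c : ℝ} (hc : 0 < c) :
    c • x ∈ hyperbolicityCone f e := by
  intro τ hτ
  have h1 : c • x + τ • e = c • (x + (τ / c) • e) := by
    rw [smul_add, smul_smul, mul_div_cancel₀ _ hc.ne']
  rw [h1, hf.eval_smul_eq]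
  exact mul_ne_zero (pow_ne_zero _ hc.ne') (hx _ (div_pos hτ hc))

/-- `Λ₊₊` is invariant under positive scaling (Renegar 2006, §2: "if `x ∈ Λ₊₊`, then `tx ∈ Λ₊₊`
for all `t > 0`"). [cite: Renegar2006, §2] -/
theorem smul_mem_openHyperbolicityCone {f : MvPolynomial σ ℝ} {d : ℕ} (hf : f.IsHomogeneous d)
    {e x : σ → ℝ} (hx : x ∈ openHyperbolicityCone f e) {c : ℝ} (hc : 0 < c) :
    c • x ∈ openHyperbolicityCone f e := by
  intro τ hτ
  have h1 : c • x + τ • e = c • (x + (τ / c) • e) := by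
    rw [smul_add, smul_smul, mul_div_cancel₀ _ hc.ne']
  rw [h1, hf.eval_smul_eq]
  exact mul_ne_zero (pow_ne_zero _ hc.ne') (hx _ (div_nonneg hτ hc.le))

/-! ### The restriction to a line, eigenvalues, and the real factorisation -/

section LinePoly

variable {R : Type*} [CommRing R]

/-- The **line polynomial** `t ↦ f(x + t e)` as an element of `R[t]` (Renegar 2006, §2: "the
univariate polynomial `t ↦ p(x + te)`"), over any commutative ring `R` (used with `R = ℝ`, and
with `R = ℂ` for complex base points). [cite: Renegar2006, §2] -/
def linePoly (f : MvPolynomial σ R) (x e : σ → R) : R[X] :=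
  MvPolynomial.aeval (fun j => Polynomial.C (e j) * Polynomial.X + Polynomial.C (x j)) f

/-- `linePoly f x e` evaluates at `t` to `f(x + t e)`. [folklore] -/
@[simp] theorem eval_linePoly (f : MvPolynomial σ R) (x e : σ → R) (t : R) :
    (linePoly f x e).eval t = MvPolynomial.eval (x + t • e) f := by
  induction f using MvPolynomial.induction_on with
  | C a => simp [linePoly]
  | add p q hp hq =>
      simp only [linePoly, map_add, Polynomial.eval_add] at hp hq ⊢
      rw [hp, hq]
  | mul_X p j hp =>
      simp only [linePoly, map_mul, Polynomial.eval_mul, MvPolynomial.aeval_X] at hp ⊢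
      rw [hp]
      congr 1
      simp only [Polynomial.eval_add, Polynomial.eval_mul, Polynomial.eval_C, Polynomial.eval_X,
        MvPolynomial.eval_X, Pi.add_apply, Pi.smul_apply, smul_eq_mul]
      ring

/-- `linePoly` commutes with a change of scalars. [folklore] -/
theorem map_linePoly {S : Type*} [CommRing S] (φ : R →+* S) (f : MvPolynomial σ R)
    (x e : σ → R) :
    (linePoly f x e).map φ = linePoly (MvPolynomial.map φ f) (φ ∘ x) (φ ∘ e) := by
  induction f using MvPolynomial.induction_on with
  | C a => simp [linePoly]
  | add p q hp hq =>
      simp only [linePoly, map_add, Polynomial.map_add] at hp hq ⊢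
      rw [hp, hq]
  | mul_X p j hp =>
      simp only [linePoly, map_mul, Polynomial.map_mul, MvPolynomial.aeval_X,
        MvPolynomial.map_X] at hp ⊢
      rw [hp]
      simp

/-- An affine-linear univariate polynomial raised to the `n`-th power has degree `≤ n`.
[folklore] -/
private theorem natDegree_linear_pow_le (a b : R) (n : ℕ) :
    ((Polynomial.C a * Polynomial.X + Polynomial.C b) ^ n).natDegree ≤ n :=
  Polynomial.natDegree_pow_le.trans
    (by simpa using Nat.mul_le_mul_left n (Polynomial.natDegree_linear_le (a := a) (b := b)))

/-- For a form of degree `d`, `t ↦ f(x + te)` has degree `≤ d`. [folklore] -/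
theorem natDegree_linePoly_le {f : MvPolynomial σ R} {d : ℕ} (hf : f.IsHomogeneous d)
    (x e : σ → R) : (linePoly f x e).natDegree ≤ d := by
  rw [linePoly, MvPolynomial.aeval_def, MvPolynomial.eval₂_eq]
  simp only [Polynomial.algebraMap_eq]
  refine Polynomial.natDegree_sum_le_of_forall_le _ _ fun m hm => ?_
  refine (Polynomial.natDegree_C_mul_le _ _).trans ((Polynomial.natDegree_prod_le _ _).trans ?_)
  rw [hf.degree_eq_sum_deg_support hm]
  exact Finset.sum_le_sum fun i _ => natDegree_linear_pow_le _ _ _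

/-- Top coefficient of `∏ᵢ (eᵢ t + xᵢ)^{mᵢ}`: it is `∏ᵢ eᵢ^{mᵢ}`. [folklore] -/
private theorem coeff_prod_linear_pow (x e : σ → R) (m : σ →₀ ℕ) (s : Finset σ) :
    (∏ i ∈ s, (Polynomial.C (e i) * Polynomial.X + Polynomial.C (x i)) ^ m i).coeff
        (∑ i ∈ s, m i) = ∏ i ∈ s, e i ^ m i := by
  classical
  induction s using Finset.induction_on with
  | empty => simp
  | insert i s hi ih =>
      rw [Finset.prod_insert hi, Finset.sum_insert hi, Finset.prod_insert hi,
        Polynomial.coeff_mul_add_eq_of_natDegree_le (natDegree_linear_pow_le _ _ _)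
          ((Polynomial.natDegree_prod_le _ _).trans
            (Finset.sum_le_sum fun k _ => natDegree_linear_pow_le _ _ _)), ih]
      congr 1
      have h := Polynomial.coeff_pow_of_natDegree_le (m := m i)
        (Polynomial.natDegree_linear_le (a := e i) (b := x i))
      rw [mul_one] at h
      rw [h]
      simp

/-- For a form `f` of degree `d`, the coefficient of `t^d` in `f(x + te)` is `f(e)`
(Saunderson–Parrilo §1.1: "`p(x + te) = p(e)[t^m + a₁(x)t^{m−1} + ⋯]`").
[cite: SaundersonParrilo2014, §1.1] -/
theorem coeff_linePoly_eq_eval {f : MvPolynomial σ R} {d : ℕ} (hf : f.IsHomogeneous d)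
    (x e : σ → R) : (linePoly f x e).coeff d = MvPolynomial.eval e f := by
  rw [linePoly, MvPolynomial.aeval_def, MvPolynomial.eval₂_eq, MvPolynomial.eval_eq]
  simp only [Polynomial.algebraMap_eq, Polynomial.finsetSum_coeff, Polynomial.coeff_C_mul]
  refine Finset.sum_congr rfl fun m hm => ?_
  rw [hf.degree_eq_sum_deg_support hm, coeff_prod_linear_pow]

/-- For a form with `f(e) ≠ 0`, no line polynomial in direction `e` vanishes. [folklore] -/
theorem linePoly_ne_zero {f : MvPolynomial σ R} {d : ℕ} (hf : f.IsHomogeneous d) {e : σ → R}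
    (he : MvPolynomial.eval e f ≠ 0) (x : σ → R) : linePoly f x e ≠ 0 := fun h0 =>
  he (by rw [← coeff_linePoly_eq_eval hf x e, h0, Polynomial.coeff_zero])

/-- For a form of degree `d` with `f(e) ≠ 0`, `t ↦ f(x + te)` has degree exactly `d`.
[cite: SaundersonParrilo2014, §1.1] -/
theorem natDegree_linePoly {f : MvPolynomial σ R} {d : ℕ} (hf : f.IsHomogeneous d) {e : σ → R}
    (he : MvPolynomial.eval e f ≠ 0) (x : σ → R) : (linePoly f x e).natDegree = d :=
  le_antisymm (natDegree_linePoly_le hf x e)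
    (Polynomial.le_natDegree_of_ne_zero (by rwa [coeff_linePoly_eq_eval hf]))

/-- … and leading coefficient `f(e)`. [cite: SaundersonParrilo2014, §1.1] -/
theorem leadingCoeff_linePoly {f : MvPolynomial σ R} {d : ℕ} (hf : f.IsHomogeneous d)
    {e : σ → R} (he : MvPolynomial.eval e f ≠ 0) (x : σ → R) :
    (linePoly f x e).leadingCoeff = MvPolynomial.eval e f := by
  rw [Polynomial.leadingCoeff, natDegree_linePoly hf he, coeff_linePoly_eq_eval hf]

end LinePoly

/-- The complexification of `linePoly f x e` evaluates at `z` to the complex expression inlined by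
the route items, `f_ℂ(x + z e)`. [folklore] -/
@[simp] theorem eval_map_linePoly (f : MvPolynomial σ ℝ) (x e : σ → ℝ) (z : ℂ) :
    ((linePoly f x e).map (algebraMap ℝ ℂ)).eval z =
      MvPolynomial.eval (fun j => (x j : ℂ) + z * (e j : ℂ))
        (MvPolynomial.map (algebraMap ℝ ℂ) f) := by
  rw [map_linePoly, eval_linePoly]
  refine congrArg (fun g : σ → ℂ => MvPolynomial.eval g (MvPolynomial.map (algebraMap ℝ ℂ) f))
    (funext fun j => ?_)
  simp

/-- Hyperbolicity through the line polynomials: `f(e) ≠ 0` and every complex root of every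
complexified `linePoly f x e` is real. [cite: Renegar2006, §2] -/
theorem isHyperbolic_iff_linePoly (f : MvPolynomial σ ℝ) (e : σ → ℝ) :
    IsHyperbolic f e ↔ MvPolynomial.eval e f ≠ 0 ∧
      ∀ (x : σ → ℝ) (z : ℂ), ((linePoly f x e).map (algebraMap ℝ ℂ)).IsRoot z → z.im = 0 := by
  simp only [isHyperbolic_iff, Polynomial.IsRoot.def, eval_map_linePoly]

/-- For hyperbolic `f`, the complex roots of the complexified line polynomial are the images of
its real roots (all its complex roots are real). [cite: Renegar2006, §2] -/
theorem IsHyperbolic.roots_map_linePoly {f : MvPolynomial σ ℝ} {e : σ → ℝ} (h : IsHyperbolic f e)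
    (x : σ → ℝ) :
    ((linePoly f x e).map (algebraMap ℝ ℂ)).roots =
      (linePoly f x e).roots.map (algebraMap ℝ ℂ) := by
  classical
  rw [← Polynomial.filter_roots_map_range_eq_map_roots (algebraMap ℝ ℂ).injective]
  refine (Multiset.filter_eq_self.2 fun z hz => ?_).symm
  have hroot := (Polynomial.mem_roots'.1 hz).2
  rw [Polynomial.IsRoot.def, eval_map_linePoly] at hroot
  have him : z.im = 0 := h.im_eq_zero x hroot
  exact ⟨z.re, Complex.ext (by simp) (by simp [him])⟩

/-- For hyperbolic `f`, `t ↦ f(x + te)` has as many real roots (with multiplicity) as its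
degree. [cite: Renegar2006, §2] -/
theorem IsHyperbolic.card_roots_linePoly {f : MvPolynomial σ ℝ} {e : σ → ℝ} (h : IsHyperbolic f e)
    (x : σ → ℝ) : Multiset.card (linePoly f x e).roots = (linePoly f x e).natDegree := by
  have hc := congrArg Multiset.card (h.roots_map_linePoly x)
  rw [Multiset.card_map, IsAlgClosed.card_roots_eq_natDegree, Polynomial.natDegree_map] at hc
  exact hc.symm

/-- **Real factorisation along lines** for hyperbolic `f`:
`f(x + te) = lc · ∏_{μ} (t − μ)` over the real roots `μ` of `linePoly f x e`.
[cite: Renegar2006, §2] -/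
theorem IsHyperbolic.eval_add_smul_eq_prod_roots {f : MvPolynomial σ ℝ} {e : σ → ℝ}
    (h : IsHyperbolic f e) (x : σ → ℝ) (t : ℝ) :
    MvPolynomial.eval (x + t • e) f =
      (linePoly f x e).leadingCoeff * ((linePoly f x e).roots.map fun μ => t - μ).prod := by
  have hfac := Polynomial.C_leadingCoeff_mul_prod_multiset_X_sub_C (h.card_roots_linePoly x)
  have hev := congrArg (Polynomial.eval t) hfac
  rw [eval_linePoly] at hev
  rw [← hev, Polynomial.eval_mul, Polynomial.eval_C, Polynomial.eval_multiset_prod,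
    Multiset.map_map]
  exact congrArg (fun s : Multiset ℝ => (linePoly f x e).leadingCoeff * s.prod)
    (Multiset.map_congr rfl fun μ _ => by simp)

/-- **Eigenvalues** of `x` with respect to `f` in direction `e` (Renegar 2006, §2: "the roots of
the characteristic polynomial `λ ↦ p(λe − x)` are the eigenvalues of `x`"), as a multiset with
multiplicities. For a form, `p(λe − x) = (−1)^d p(x + (−λ)e)`, so they are realised here as the
negatives of the roots of `t ↦ f(x + te)` (`mem_eigenvalues_iff`). [cite: Renegar2006, §2] -/
def eigenvalues (f : MvPolynomial σ ℝ) (e x : σ → ℝ) : Multiset ℝ :=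
  (linePoly f x e).roots.map fun μ => -μ

/-- `λ` is an eigenvalue of `x` iff `f(x − λ e) = 0` (form `f` with `f(e) ≠ 0`).
[cite: Renegar2006, §2] -/
theorem mem_eigenvalues_iff {f : MvPolynomial σ ℝ} {d : ℕ} (hf : f.IsHomogeneous d) {e : σ → ℝ}
    (he : MvPolynomial.eval e f ≠ 0) {x : σ → ℝ} {lam : ℝ} :
    lam ∈ eigenvalues f e x ↔ MvPolynomial.eval (x - lam • e) f = 0 := by
  rw [eigenvalues, Multiset.mem_map]
  constructor
  · rintro ⟨μ, hμ, rfl⟩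
    have := (Polynomial.mem_roots (linePoly_ne_zero hf he x)).1 hμ
    rw [Polynomial.IsRoot.def, eval_linePoly] at this
    simpa [sub_eq_add_neg] using this
  · intro h0
    refine ⟨-lam, (Polynomial.mem_roots (linePoly_ne_zero hf he x)).2 ?_, neg_neg lam⟩
    rw [Polynomial.IsRoot.def, eval_linePoly, neg_smul, ← sub_eq_add_neg, h0]

/-- A form of degree `d` hyperbolic w.r.t. `e` has exactly `d` eigenvalues at every point
(Renegar 2006, §2: "`λ₁(x) ≤ … ≤ λₙ(x)`, counting multiplicities"). [cite: Renegar2006, §2] -/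
theorem card_eigenvalues {f : MvPolynomial σ ℝ} {d : ℕ} (hf : f.IsHomogeneous d) {e : σ → ℝ}
    (h : IsHyperbolic f e) (x : σ → ℝ) : Multiset.card (eigenvalues f e x) = d := by
  rw [eigenvalues, Multiset.card_map, h.card_roots_linePoly, natDegree_linePoly hf h.eval_ne_zero]

/-- **`f(x + te) = f(e) ∏ᵢ (t + λᵢ(x))`** for a form `f` hyperbolic w.r.t. `e`.
[cite: Renegar2006, §2] -/
theorem eval_add_smul_eq_eval_mul_prod_eigenvalues {f : MvPolynomial σ ℝ} {d : ℕ}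
    (hf : f.IsHomogeneous d) {e : σ → ℝ} (h : IsHyperbolic f e) (x : σ → ℝ) (t : ℝ) :
    MvPolynomial.eval (x + t • e) f =
      MvPolynomial.eval e f * ((eigenvalues f e x).map fun lam => t + lam).prod := by
  rw [h.eval_add_smul_eq_prod_roots, leadingCoeff_linePoly hf h.eval_ne_zero, eigenvalues,
    Multiset.map_map]
  exact congrArg (fun s : Multiset ℝ => MvPolynomial.eval e f * s.prod)
    (Multiset.map_congr rfl fun μ _ => by simp [sub_eq_add_neg])

/-- Renegar 2006, §2: **`p(x) = p(e) ∏ⱼ λⱼ(x)`**. [cite: Renegar2006, §2] -/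
theorem eval_eq_eval_mul_prod_eigenvalues {f : MvPolynomial σ ℝ} {d : ℕ} (hf : f.IsHomogeneous d)
    {e : σ → ℝ} (h : IsHyperbolic f e) (x : σ → ℝ) :
    MvPolynomial.eval x f = MvPolynomial.eval e f * (eigenvalues f e x).prod := by
  simpa using eval_add_smul_eq_eval_mul_prod_eigenvalues hf h x 0

/-- **`Λ₊ = {x : λ_min(x) ≥ 0}`** (Renegar 2006, §2): for a form hyperbolic w.r.t. `e`, `x ∈ Λ₊`
iff all eigenvalues of `x` are nonnegative. [cite: Renegar2006, §2 (definition of Λ₊)] -/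
theorem mem_hyperbolicityCone_iff_eigenvalues_nonneg {f : MvPolynomial σ ℝ} {d : ℕ}
    (hf : f.IsHomogeneous d) {e : σ → ℝ} (h : IsHyperbolic f e) (x : σ → ℝ) :
    x ∈ hyperbolicityCone f e ↔ ∀ lam ∈ eigenvalues f e x, 0 ≤ lam := by
  rw [mem_hyperbolicityCone_iff_forall_root_nonpos]
  constructor
  · intro H lam hlam
    have h0 := (mem_eigenvalues_iff hf h.eval_ne_zero).1 hlam
    have := H (-lam) (by rwa [neg_smul, ← sub_eq_add_neg])
    linarith
  · intro H t ht
    have hmem : -t ∈ eigenvalues f e x :=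
      (mem_eigenvalues_iff hf h.eval_ne_zero).2 (by rwa [neg_smul, sub_neg_eq_add])
    have := H _ hmem
    linarith

/-- **`Λ₊₊ = {x : λ_min(x) > 0}`** (Renegar 2006, §2): for a form hyperbolic w.r.t. `e`, `x ∈ Λ₊₊`
iff all eigenvalues of `x` are positive. [cite: Renegar2006, §2 (definition of Λ₊₊)] -/
theorem mem_openHyperbolicityCone_iff_eigenvalues_pos {f : MvPolynomial σ ℝ} {d : ℕ}
    (hf : f.IsHomogeneous d) {e : σ → ℝ} (h : IsHyperbolic f e) (x : σ → ℝ) :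
    x ∈ openHyperbolicityCone f e ↔ ∀ lam ∈ eigenvalues f e x, 0 < lam := by
  rw [mem_openHyperbolicityCone_iff_forall_root_neg]
  constructor
  · intro H lam hlam
    have h0 := (mem_eigenvalues_iff hf h.eval_ne_zero).1 hlam
    have := H (-lam) (by rwa [neg_smul, ← sub_eq_add_neg])
    linarith
  · intro H t ht
    have hmem : -t ∈ eigenvalues f e x :=
      (mem_eigenvalues_iff hf h.eval_ne_zero).2 (by rwa [neg_smul, sub_neg_eq_add])
    have := H _ hmem
    linarith

/-! ### Closedness of `Λ₊` -/

/-- On `Λ₊`, `|f(e)| τ^d ≤ |f(x + τe)|` for `τ ≥ 0` (each factor `τ + λᵢ(x) ≥ τ`). [folklore] -/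
theorem abs_eval_mul_pow_le_abs_eval {f : MvPolynomial σ ℝ} {d : ℕ} (hf : f.IsHomogeneous d)
    {e : σ → ℝ} (h : IsHyperbolic f e) {x : σ → ℝ} (hx : x ∈ hyperbolicityCone f e) {τ : ℝ}
    (hτ : 0 ≤ τ) : |MvPolynomial.eval e f| * τ ^ d ≤ |MvPolynomial.eval (x + τ • e) f| := by
  rw [eval_add_smul_eq_eval_mul_prod_eigenvalues hf h x τ, abs_mul]
  refine mul_le_mul_of_nonneg_left ?_ (abs_nonneg _)
  have hnn := (mem_hyperbolicityCone_iff_eigenvalues_nonneg hf h x).1 hx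
  calc τ ^ d = ((eigenvalues f e x).map fun _ => τ).prod := by
        rw [Multiset.map_const', Multiset.prod_replicate, card_eigenvalues hf h]
    _ ≤ ((eigenvalues f e x).map fun lam => τ + lam).prod :=
        Multiset.prod_map_le_prod_map₀ _ _ (fun _ _ => hτ)
          (fun lam hlam => le_add_of_nonneg_right (hnn lam hlam))
    _ ≤ _ := le_abs_self _

/-- **The closed hyperbolicity cone is closed** (Renegar 2006, §2: `Λ₊` is the closure of `Λ₊₊`):
here `Λ₊ = ⋂_{τ>0} {x : |f(e)| τ^d ≤ |f(x + τe)|}`, an intersection of closed sets.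
[cite: Renegar2006, §2] -/
theorem isClosed_hyperbolicityCone {f : MvPolynomial σ ℝ} {d : ℕ} (hf : f.IsHomogeneous d)
    {e : σ → ℝ} (h : IsHyperbolic f e) : IsClosed (hyperbolicityCone f e) := by
  have key : hyperbolicityCone f e = ⋂ τ : {τ : ℝ // 0 < τ},
      {x | |MvPolynomial.eval e f| * (τ : ℝ) ^ d ≤ |MvPolynomial.eval (x + (τ : ℝ) • e) f|} := by
    ext x
    simp only [Set.mem_iInter, Set.mem_setOf_eq]
    constructor
    · intro hx τ
      exact abs_eval_mul_pow_le_abs_eval hf h hx τ.2.le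
    · intro hx τ hτ h0
      have hle := hx ⟨τ, hτ⟩
      rw [h0, abs_zero] at hle
      have hpos : 0 < |MvPolynomial.eval e f| * τ ^ d :=
        mul_pos (abs_pos.2 h.eval_ne_zero) (pow_pos hτ _)
      exact absurd hle (not_le.2 hpos)
  rw [key]
  refine isClosed_iInter fun τ => isClosed_le continuous_const ?_
  exact continuous_abs.comp
    ((MvPolynomial.continuous_eval f).comp (continuous_id.add continuous_const))

/-! ### Linear substitutions keeping the direction -/

section LinearPullback

open scoped Matrix

variable {ι : Type*} [Fintype ι]

/-- Real evaluation of the linear pull-back `f ∘ A` (substitution `Xᵢ ↦ Σₖ Aᵢₖ Yₖ`, written with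
`bind₁`): `(f ∘ A)(y) = f(A y)`. [folklore] -/
theorem eval_bind₁_linear (A : Matrix σ ι ℝ) (f : MvPolynomial σ ℝ) (y : ι → ℝ) :
    MvPolynomial.eval y (bind₁ (fun i => ∑ k, C (A i k) * X k) f) =
      MvPolynomial.eval (A *ᵥ y) f := by
  rw [show MvPolynomial.eval y (bind₁ (fun i => ∑ k, C (A i k) * X k) f) =
      MvPolynomial.eval (fun i => MvPolynomial.eval y (∑ k, C (A i k) * X k)) f from
    eval₂Hom_bind₁ _ _ _ _]
  refine congrArg (fun g : σ → ℝ => MvPolynomial.eval g f) (funext fun i => ?_)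
  simp [map_sum, Matrix.mulVec, dotProduct]

/-- **Linear preimages**: for a real matrix `A` and the pull-back `f ∘ A`,
`Λ₊(f ∘ A, e') = A⁻¹(Λ₊(f, A e'))`. [folklore] -/
theorem hyperbolicityCone_bind₁_linear (A : Matrix σ ι ℝ) (f : MvPolynomial σ ℝ) (e' : ι → ℝ) :
    hyperbolicityCone (bind₁ (fun i => ∑ k, C (A i k) * X k) f) e' =
      (fun y => A *ᵥ y) ⁻¹' hyperbolicityCone f (A *ᵥ e') := by
  ext y
  simp only [mem_hyperbolicityCone_iff, Set.mem_preimage, eval_bind₁_linear, Matrix.mulVec_add,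
    Matrix.mulVec_smul]

/-- `Λ₊₊(f ∘ A, e') = A⁻¹(Λ₊₊(f, A e'))`. [folklore] -/
theorem openHyperbolicityCone_bind₁_linear (A : Matrix σ ι ℝ) (f : MvPolynomial σ ℝ)
    (e' : ι → ℝ) :
    openHyperbolicityCone (bind₁ (fun i => ∑ k, C (A i k) * X k) f) e' =
      (fun y => A *ᵥ y) ⁻¹' openHyperbolicityCone f (A *ᵥ e') := by
  ext y
  simp only [mem_openHyperbolicityCone_iff, Set.mem_preimage, eval_bind₁_linear,
    Matrix.mulVec_add, Matrix.mulVec_smul]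

/-- **Linear pull-backs of hyperbolic polynomials are hyperbolic**: if `f` is hyperbolic w.r.t.
`A e'` then `f ∘ A` is hyperbolic w.r.t. `e'` (in particular: restriction to a subspace through
the direction). [folklore] -/
theorem IsHyperbolic.bind₁_linear (A : Matrix σ ι ℝ) {f : MvPolynomial σ ℝ} {e' : ι → ℝ}
    (h : IsHyperbolic f (A *ᵥ e')) :
    IsHyperbolic (bind₁ (fun i => ∑ k, C (A i k) * X k) f) e' := by
  refine ⟨by rw [eval_bind₁_linear]; exact h.eval_ne_zero, fun y z hz => h.im_eq_zero
    (A *ᵥ y) (z := z) ?_⟩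
  rw [map_bind₁] at hz
  rw [show MvPolynomial.eval (fun j => (y j : ℂ) + z * (e' j : ℂ))
      (bind₁ (fun i => MvPolynomial.map (algebraMap ℝ ℂ) (∑ k, C (A i k) * X k))
        (MvPolynomial.map (algebraMap ℝ ℂ) f)) =
      MvPolynomial.eval (fun i => MvPolynomial.eval (fun j => (y j : ℂ) + z * (e' j : ℂ))
        (MvPolynomial.map (algebraMap ℝ ℂ) (∑ k, C (A i k) * X k)))
        (MvPolynomial.map (algebraMap ℝ ℂ) f) from eval₂Hom_bind₁ _ _ _ _] at hz
  have hfun : (fun j => (((A *ᵥ y) j : ℝ) : ℂ) + z * (((A *ᵥ e') j : ℝ) : ℂ)) =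
      fun i => MvPolynomial.eval (fun j => (y j : ℂ) + z * (e' j : ℂ))
        (MvPolynomial.map (algebraMap ℝ ℂ) (∑ k, C (A i k) * X k)) := by
    funext i
    simp only [Matrix.mulVec, dotProduct, map_sum, map_mul, MvPolynomial.map_C,
      MvPolynomial.map_X, MvPolynomial.eval_C, MvPolynomial.eval_X, Complex.coe_algebraMap,
      Complex.ofReal_sum, Complex.ofReal_mul, Finset.mul_sum, ← Finset.sum_add_distrib]
    exact Finset.sum_congr rfl fun k _ => by ring
  rw [hfun]
  exact hz

end LinearPullback

/-! ### Examples: the orthant; real stable polynomials -/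

/-- `∏ᵢ Xᵢ` is hyperbolic w.r.t. `𝟙 = (1,…,1)` (Renegar 2006, §2, "LP"; Saunderson–Parrilo §1.1):
a zero of `∏ (xⱼ + z)` is `z = −xⱼ ∈ ℝ`. [cite: SaundersonParrilo2014, §1.1] -/
theorem isHyperbolic_prod_X [Fintype σ] :
    IsHyperbolic (∏ i, X i : MvPolynomial σ ℝ) (fun _ => 1) := by
  refine ⟨by simp [map_prod], fun x z hz => ?_⟩
  simp only [map_prod, MvPolynomial.map_X, MvPolynomial.eval_X, Complex.ofReal_one, mul_one,
    Finset.prod_eq_zero_iff, Finset.mem_univ, true_and] at hz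
  obtain ⟨i, hi⟩ := hz
  have hz' : z = -(x i : ℂ) := by linear_combination hi
  rw [hz']
  simp

/-- The closed hyperbolicity cone of `∏ᵢ Xᵢ` w.r.t. `𝟙` is the nonnegative orthant
(Saunderson–Parrilo §1.1: "the associated closed hyperbolicity cone is the non-negative orthant").
[cite: SaundersonParrilo2014, §1.1] -/
theorem hyperbolicityCone_prod_X [Fintype σ] :
    hyperbolicityCone (∏ i, X i : MvPolynomial σ ℝ) (fun _ => 1) = {x | ∀ i, 0 ≤ x i} := by
  ext x
  simp only [mem_hyperbolicityCone_iff, map_prod, MvPolynomial.eval_X, Pi.add_apply,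
    Pi.smul_apply, smul_eq_mul, mul_one, Finset.prod_ne_zero_iff, Finset.mem_univ, true_imp_iff,
    Set.mem_setOf_eq]
  constructor
  · intro h i
    by_contra hneg
    exact h (-x i) (by linarith [not_le.1 hneg]) i (by ring)
  · intro h τ hτ i
    exact (add_pos_of_nonneg_of_pos (h i) hτ).ne'

/-- The open hyperbolicity cone of `∏ᵢ Xᵢ` w.r.t. `𝟙` is the positive orthant (Renegar 2006,
§2: "In LP, … `Λ₊₊ = ℝⁿ₊₊`"). [cite: Renegar2006, §2] -/
theorem openHyperbolicityCone_prod_X [Fintype σ] :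
    openHyperbolicityCone (∏ i, X i : MvPolynomial σ ℝ) (fun _ => 1) = {x | ∀ i, 0 < x i} := by
  ext x
  simp only [mem_openHyperbolicityCone_iff, map_prod, MvPolynomial.eval_X, Pi.add_apply,
    Pi.smul_apply, smul_eq_mul, mul_one, Finset.prod_ne_zero_iff, Finset.mem_univ, true_imp_iff,
    Set.mem_setOf_eq]
  constructor
  · intro h i
    by_contra hneg
    exact h (-x i) (by linarith [not_lt.1 hneg]) i (by ring)
  · intro h τ hτ i
    exact (add_pos_of_pos_of_nonneg (h i) hτ).ne'

open Literature.Combinatorics.StablePolynomials in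
/-- **Real stable ⇒ hyperbolic in positive directions** (Brändén 2007 §3 / Borcea–Brändén 2009
§1, line criterion: a real stable `p` is real-rooted along every line `a + tb`, `b ∈ ℝⁿ₊₊`;
tree lemma `IsRealStable.im_eq_zero_of_eval₂_line_eq_zero`): if moreover `p(e) ≠ 0` then `p` is
hyperbolic in direction `e`. [cite: Branden2007, §3 (after Remark 3.5)] -/
theorem isHyperbolic_of_isRealStable {p : MvPolynomial σ ℝ} (hp : IsRealStable p) {e : σ → ℝ}
    (he : ∀ i, 0 < e i) (hpe : MvPolynomial.eval e p ≠ 0) : IsHyperbolic p e :=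
  ⟨hpe, fun x z hz =>
    hp.im_eq_zero_of_eval₂_line_eq_zero x he (t := z) (by rwa [MvPolynomial.eval_map] at hz)⟩

open Literature.Combinatorics.StablePolynomials in
/-- A real stable *form* does not vanish at any point of the open positive orthant: otherwise
`p((1 + t)e) = (1+t)^d p(e) = 0` at `t = i`, a zero in `Hⁿ`. [folklore] -/
theorem eval_ne_zero_of_isRealStable {p : MvPolynomial σ ℝ} {d : ℕ} (hp : IsRealStable p)
    (hhom : p.IsHomogeneous d) {e : σ → ℝ} (he : ∀ i, 0 < e i) : MvPolynomial.eval e p ≠ 0 := by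
  intro h0
  refine hp (fun j => Complex.I * (e j : ℂ)) (fun j => by simpa using he j) ?_
  have h1 : (fun j => Complex.I * (e j : ℂ)) = Complex.I • fun j => (e j : ℂ) := by
    funext j; simp
  have h2 : MvPolynomial.eval (fun j => (e j : ℂ)) (MvPolynomial.map (algebraMap ℝ ℂ) p)
      = ((MvPolynomial.eval e p : ℝ) : ℂ) := by
    rw [← Complex.coe_algebraMap, MvPolynomial.map_eval]
    rfl
  rw [h1, (hhom.map (algebraMap ℝ ℂ)).eval_smul_eq, h2, h0]
  simp

open Literature.Combinatorics.StablePolynomials in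
/-- **Real stable forms are hyperbolic w.r.t. every positive direction** (e.g. `𝟙`): the case of
the route's permanental polynomials. [cite: Branden2007, §3 (after Remark 3.5)] -/
theorem isHyperbolic_of_isRealStable_of_isHomogeneous {p : MvPolynomial σ ℝ} {d : ℕ}
    (hp : IsRealStable p) (hhom : p.IsHomogeneous d) {e : σ → ℝ} (he : ∀ i, 0 < e i) :
    IsHyperbolic p e :=
  isHyperbolic_of_isRealStable hp he (eval_ne_zero_of_isRealStable hp hhom he)

end Literature.AlgebraicGeometry.HyperbolicPolynomials
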